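import Literature.NumberTheory.Sieve.SmoothZetaDecayBrunTitchmarsh
import HarnessLib

/-!
# The decay sum of `ζ(s, y)` on a block of primes `(z/e³, z]`: Brun–Titchmarsh up to `|t| ≤ κ z^{9/10}`, pigeonhole up to `|t| ≤ z/(16 log z)`

Topic `Literature/NumberTheory/Sieve`; a PROVED tool file toward Hildebrand–Tenenbaum's saddle-point theorem
[HildebrandTenenbaum1986, Thm 1] WITHOUT their Lemma 6 (Vinogradov's zero-free region): lower bounds for the
contribution of one block of primes `z/e³ < p ≤ z` (`z ≤ y`) to
`W(t) = Σ_{p ≤ y} p^{-σ}(1 - cos(t log p))` (for which `|ζ(σ + it, y)| ≤ ζ(σ, y) e^{-W}`,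
`norm_smoothZetaC_le_mul_exp_neg_decaySum`), uniformly in `σ ≥ 0`:

* `exists_blockDecaySum_ge` — **Brun–Titchmarsh regime**: there are absolute `c, κ > 0`, `z₀` with
  `Σ_{z/e³ < p ≤ z} p^{-σ}(1 - cos(t log p)) ≥ c z^{1-σ}/log z` for all real `z ≥ z₀`, `σ ≥ 0` and
  `3 ≤ |t| ≤ κ z^{9/10}` — the tree's `exists_decaySum_ge_linear` (block `(y/e³, y]`, `|t| ≤ κ √y`, `σ ≥ 3/5`) with
  the block detached from `y`, the exponent `1/2` raised to `9/10` (the bad primes lie in `≤ 3|t|/2` intervals of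
  length `≍ ε' z/|t| ≥ z^{1/10}`, on which the Brun–Titchmarsh inequality of the tree, `sum_log_primes_Ioc_le`,
  still saves a factor `≍ 1/log z`), and no lower restriction on `σ`;
* `exists_blockDecaySum_ge_of_le_div_log` — **pigeonhole regime**: there are absolute `c > 0`, `z₀` with
  `Σ_{z/e³ < p ≤ z} p^{-σ}(1 - cos(t log p)) ≥ c (t/z)² z^{1-σ}/log z` for `z ≥ z₀`, `σ ≥ 0`,
  `3 ≤ |t| ≤ z/(16 log z)`: with `ε' = |t|/(480 z)` the bad intervals have length `< 1`, so each holds at most one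
  prime and the bad `θ`-mass is `≤ (3|t|/2 + 1) log z ≤ z/10`; the good primes give `1 - cos ε' ≥ (2/π²)ε'²`.
  (For `|t| ≥ z^{9/10}` this is `≫ z^{4/5-σ}/log z`, ample against the `O(log)` losses of a Perron formula.)

Summing the first bound over the blocks `z = y, y/e³, y/e⁶, …` gives Hildebrand–Tenenbaum's
`W ≫ (y^{1-α} - Z^{1-α})/((1-α) log y) ≍ ū` (op. cit. Lemma 8 (ii), (3.16)) in the range `|t| ≤ κ Z^{9/10}`, and
the second covers the remaining `|t| ≤ y/(16 log y)`; neither uses any information on the zeros of `ζ`.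

## References

* [HildebrandTenenbaum1986] A. Hildebrand, G. Tenenbaum, Trans. AMS 296 (1986) 265–290, §3 Lemma 8 (ii)–(iii)
  and the proof of (3.16) (held: `paper:doi-10-1090-s0002-9947-1986-0837811-1`, pp. 275–276).
* H. Halberstam, H.-E. Richert, *Sieve Methods*, Academic Press 1974, Ch. 3 (Brun–Titchmarsh; as in the tree's
  `BrunTitchmarshShortInterval`).

## Tree / Mathlib

Tree: `sum_log_primes_Ioc_le` (`BrunTitchmarshShortInterval`), `exists_theta_ge_linear` (`SmoothSaddlePointApprox`),
`theta_sub_theta_eq_sum_sdiff`, `cos_le_cos_of_forall_dist`, `two_div_pi_sq_mul_sq_le_one_sub_cos`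
(`SmoothZetaDecayChebyshev`, `SmoothZetaComplex`), `exp_sub_exp_neg_bounds`, `exp_three_gt`
(`SmoothZetaDecayBrunTitchmarsh`). Mathlib: `Chebyshev.theta_le_log4_mul_x`, `isLittleO_log_rpow_atTop`.
-/

noncomputable section

open Real Finset Chebyshev

namespace Literature.NumberTheory.Sieve

/-! ### Auxiliary facts -/

/-- Sums of a non-negative function over a `Finset.biUnion` are at most the iterated sums. [folklore] -/
private theorem sum_biUnion_le_sum'' {ι κ : Type*} [DecidableEq κ] (s : Finset ι) (t : ι → Finset κ)
    {f : κ → ℝ} (hf : ∀ x, 0 ≤ f x) :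
    ∑ x ∈ s.biUnion t, f x ≤ ∑ i ∈ s, ∑ x ∈ t i, f x := by
  classical
  induction s using Finset.induction_on with
  | empty => simp
  | insert a s ha ih =>
    rw [Finset.biUnion_insert, Finset.sum_insert ha]
    have hu := Finset.sum_union_inter (s₁ := t a) (s₂ := s.biUnion t) (f := f)
    have hi : 0 ≤ ∑ x ∈ t a ∩ s.biUnion t, f x := Finset.sum_nonneg fun x _ ↦ hf x
    linarith

/-- `e^{5.3} ≤ 250`, i.e. `1/250 ≤ e^{-5.3}`. [folklore] -/
theorem one_div_le_exp_neg : (1 / 250 : ℝ) ≤ Real.exp (-(53 / 10)) := by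
  rw [Real.exp_neg, le_inv_comm₀ (by norm_num) (Real.exp_pos _)]
  have h1 : Real.exp (53 / 10) ≤ Real.exp 1 ^ 6 / Real.exp (7 / 10) := by
    rw [le_div_iff₀ (Real.exp_pos _), ← Real.exp_add, Real.exp_one_pow]
    norm_num
  have h2 : Real.exp 1 ^ 6 ≤ (2.7182818286 : ℝ) ^ 6 :=
    pow_le_pow_left₀ (Real.exp_pos 1).le Real.exp_one_lt_d9.le 6
  have h3 : (1 : ℝ) + 7 / 10 ≤ Real.exp (7 / 10) := by
    have := Real.add_one_le_exp (7 / 10 : ℝ); linarith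
  calc Real.exp (53 / 10) ≤ Real.exp 1 ^ 6 / Real.exp (7 / 10) := h1
    _ ≤ (2.7182818286 : ℝ) ^ 6 / (1 + 7 / 10) := div_le_div₀ (by positivity) h2 (by norm_num) h3
    _ ≤ (1 / 250)⁻¹ := by norm_num

/-- `e^{2.3} ≤ 12`. [folklore] -/
theorem exp_le_twelve : Real.exp (23 / 10) ≤ 12 := by
  have h1 : Real.exp (23 / 10) ≤ Real.exp 1 ^ 3 / Real.exp (7 / 10) := by
    rw [le_div_iff₀ (Real.exp_pos _), ← Real.exp_add, Real.exp_one_pow]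
    norm_num
  have h2 : Real.exp 1 ^ 3 ≤ (2.7182818286 : ℝ) ^ 3 :=
    pow_le_pow_left₀ (Real.exp_pos 1).le Real.exp_one_lt_d9.le 3
  have h3 : (1 : ℝ) + 7 / 10 ≤ Real.exp (7 / 10) := by
    have := Real.add_one_le_exp (7 / 10 : ℝ); linarith
  calc Real.exp (23 / 10) ≤ Real.exp 1 ^ 3 / Real.exp (7 / 10) := h1
    _ ≤ (2.7182818286 : ℝ) ^ 3 / (1 + 7 / 10) := div_le_div₀ (by positivity) h2 (by norm_num) h3
    _ ≤ 12 := by norm_num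

/-- **The `θ`-mass of a block**: there is `z₀` such that `θ(z) - θ(z/e³) ≥ 0.27 z` for all `z ≥ z₀`
(Chebyshev: `θ(z) ≥ (log 2/2) z - c₁`, `θ(z/e³) ≤ log 4 · z/e³`). [folklore] -/
theorem exists_theta_block_ge :
    ∃ z₀ : ℝ, 0 < z₀ ∧ ∀ z : ℝ, z₀ ≤ z → 27 / 100 * z ≤ θ z - θ (z * Real.exp (-3)) := by
  obtain ⟨c₁, hc₁, hθ⟩ := exists_theta_ge_linear
  refine ⟨140 * c₁ + 1, by positivity, fun z hz => ?_⟩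
  have hz0 : 0 < z := by linarith [hc₁]
  have h1 := hθ z hz0.le
  have h2 := theta_le_log4_mul_x (x := z * Real.exp (-3)) (by positivity)
  have hl2 := Real.log_two_gt_d9
  have hl4 : Real.log 4 ≤ 1.3863 := by
    have h : Real.log 4 = 2 * Real.log 2 := by
      rw [show (4 : ℝ) = 2 ^ 2 by norm_num, Real.log_pow]; push_cast; ring
    rw [h]; have := Real.log_two_lt_d9; linarith
  have he3 : Real.exp (-3) ≤ 1 / 20 := by
    rw [Real.exp_neg, inv_le_comm₀ (Real.exp_pos 3) (by norm_num)]
    linarith [exp_three_gt]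
  have h3 : θ (z * Real.exp (-3)) ≤ 1.3863 * (z * (1 / 20)) :=
    h2.trans (mul_le_mul hl4 (mul_le_mul_of_nonneg_left he3 hz0.le) (by positivity) (by norm_num))
  have h4 : 0.3465 * z ≤ Real.log 2 / 2 * z := mul_le_mul_of_nonneg_right (by linarith) hz0.le
  have hc₁z : c₁ ≤ z / 140 := by linarith
  linarith

variable {z σ t : ℝ}

/-- The block of primes `z/e³ < p ≤ z`, as `primesLE ⌊z⌋ \ primesLE ⌊z/e³⌋`: membership. [folklore] -/
theorem mem_block_iff_aux {p : ℕ} (hz : 0 ≤ z)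
    (hp : p ∈ Nat.primesLE ⌊z⌋₊ \ Nat.primesLE ⌊z * Real.exp (-3)⌋₊) :
    p.Prime ∧ z * Real.exp (-3) < p ∧ (p : ℝ) ≤ z := by
  obtain ⟨hpz, hpa⟩ := Finset.mem_sdiff.1 hp
  obtain ⟨hple, hpp⟩ := Nat.mem_primesLE.1 hpz
  refine ⟨hpp, ?_, le_trans (by exact_mod_cast hple) (Nat.floor_le hz)⟩
  have hnot : ¬ p ≤ ⌊z * Real.exp (-3)⌋₊ := fun h => hpa (Nat.mem_primesLE.2 ⟨h, hpp⟩)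
  push Not at hnot
  exact lt_of_lt_of_le (Nat.lt_floor_add_one _) (by exact_mod_cast hnot)

/-- **The good primes of a block carry the decay.** If a set `Good` of primes `z/e³ < p ≤ z` (`z > 1`) all of
whose `t log p` stay at distance `≥ ε'` from `2πℤ` has `θ`-mass `≥ m`, then
`Σ_{z/e³ < p ≤ z} p^{-σ}(1 - cos(t log p)) ≥ (1 - cos ε') z^{-σ} m/log z` (`σ ≥ 0`, `0 ≤ ε'`). [folklore] -/
theorem blockDecaySum_ge_of_good_mass (hz : 1 < z) (hσ : 0 ≤ σ) {ε' m : ℝ} (hε' : 0 ≤ ε')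
    {Good : Finset ℕ} (hsub : Good ⊆ Nat.primesLE ⌊z⌋₊ \ Nat.primesLE ⌊z * Real.exp (-3)⌋₊)
    (hfar : ∀ p ∈ Good, ∀ k : ℤ, ε' ≤ |t * Real.log p - k * (2 * Real.pi)|)
    (hgood : m ≤ ∑ p ∈ Good, Real.log p) :
    (1 - Real.cos ε') * z ^ (-σ) / Real.log z * m ≤
      ∑ p ∈ Nat.primesLE ⌊z⌋₊ \ Nat.primesLE ⌊z * Real.exp (-3)⌋₊,
        (p : ℝ) ^ (-σ) * (1 - Real.cos (t * Real.log p)) := by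
  have hz0 : 0 < z := by linarith
  have hL0 : 0 < Real.log z := Real.log_pos hz
  set δ : ℝ := 1 - Real.cos ε' with hδ
  have hδ0 : 0 ≤ δ := by rw [hδ]; linarith [Real.cos_le_one ε']
  have hzσ : 0 < z ^ (-σ) := Real.rpow_pos_of_pos hz0 _
  set Q := Nat.primesLE ⌊z⌋₊ \ Nat.primesLE ⌊z * Real.exp (-3)⌋₊ with hQ
  have hterm : ∀ p ∈ Good, δ * z ^ (-σ) / Real.log z * Real.log p ≤
      (p : ℝ) ^ (-σ) * (1 - Real.cos (t * Real.log p)) := by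
    intro p hp
    obtain ⟨hpp, -, hpz⟩ := mem_block_iff_aux hz0.le (hsub hp)
    have hp0 : (0 : ℝ) < p := by exact_mod_cast hpp.pos
    have hcos : Real.cos (t * Real.log p) ≤ Real.cos ε' := cos_le_cos_of_forall_dist hε' (hfar p hp)
    have hone : δ ≤ 1 - Real.cos (t * Real.log p) := by rw [hδ]; linarith
    have hpow : z ^ (-σ) ≤ (p : ℝ) ^ (-σ) := Real.rpow_le_rpow_of_nonpos hp0 hpz (by linarith)
    have hlogp : Real.log p ≤ Real.log z := Real.log_le_log hp0 hpz
    have hlogp0 : 0 ≤ Real.log p := Real.log_nonneg (by exact_mod_cast hpp.one_lt.le)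
    calc δ * z ^ (-σ) / Real.log z * Real.log p = (δ * z ^ (-σ)) * (Real.log p / Real.log z) := by
          field_simp
      _ ≤ (δ * z ^ (-σ)) * 1 := by
          refine mul_le_mul_of_nonneg_left ?_ (by positivity)
          rwa [div_le_one hL0]
      _ = z ^ (-σ) * δ := by ring
      _ ≤ (p : ℝ) ^ (-σ) * (1 - Real.cos (t * Real.log p)) :=
          mul_le_mul hpow hone hδ0 (Real.rpow_nonneg hp0.le _)
  have hnonneg : ∀ p ∈ Q, 0 ≤ (p : ℝ) ^ (-σ) * (1 - Real.cos (t * Real.log p)) := by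
    intro p _
    exact mul_nonneg (Real.rpow_nonneg (Nat.cast_nonneg _) _) (by linarith [Real.cos_le_one (t * Real.log p)])
  calc δ * z ^ (-σ) / Real.log z * m ≤ δ * z ^ (-σ) / Real.log z * ∑ p ∈ Good, Real.log p :=
        mul_le_mul_of_nonneg_left hgood (by positivity)
    _ = ∑ p ∈ Good, δ * z ^ (-σ) / Real.log z * Real.log p := by rw [Finset.mul_sum]
    _ ≤ ∑ p ∈ Good, (p : ℝ) ^ (-σ) * (1 - Real.cos (t * Real.log p)) := Finset.sum_le_sum hterm
    _ ≤ ∑ p ∈ Q, (p : ℝ) ^ (-σ) * (1 - Real.cos (t * Real.log p)) :=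
        Finset.sum_le_sum_of_subset_of_nonneg hsub fun p hp _ => hnonneg p hp

/-- **Every bad prime of the block lies in one of `≤ 3|t|/2 + O(1)` exponential intervals.** For `t > 0`,
`P = 2π/t`, `0 < r`, a prime `z/e³ < p ≤ z` (`z > 0`, `L = log z`) with `|t log p - 2πk| < r t` for some
`k ∈ ℤ` lies in `⋃_{k ∈ [⌊(L-3-r)/P⌋, ⌈(L+r)/P⌉]} {primes in (⌊e^{kP-r}⌋, ⌈e^{kP+r}⌉]}`. [folklore] -/
theorem mem_biUnion_of_bad (hz : 0 < z) (ht : 0 < t) {r : ℝ} (hr : 0 < r) {p : ℕ}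
    (hpQ : p ∈ Nat.primesLE ⌊z⌋₊ \ Nat.primesLE ⌊z * Real.exp (-3)⌋₊)
    (hbad : ∃ k : ℤ, |t * Real.log p - k * (2 * Real.pi)| < r * t) :
    p ∈ (Finset.Icc ⌊(Real.log z - 3 - r) / (2 * Real.pi / t)⌋ ⌈(Real.log z + r) / (2 * Real.pi / t)⌉).biUnion
        (fun k : ℤ => (Ioc ⌊Real.exp (k * (2 * Real.pi / t) - r)⌋₊
          (⌊Real.exp (k * (2 * Real.pi / t) - r)⌋₊ + (⌈Real.exp (k * (2 * Real.pi / t) + r)⌉₊ -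
            ⌊Real.exp (k * (2 * Real.pi / t) - r)⌋₊))).filter Nat.Prime) := by
  set P : ℝ := 2 * Real.pi / t with hP
  set L : ℝ := Real.log z with hL
  have hP0 : 0 < P := by positivity
  obtain ⟨k, hk⟩ := hbad
  obtain ⟨hpp, hpa, hpz⟩ := mem_block_iff_aux hz.le hpQ
  have hp0 : (0 : ℝ) < p := by exact_mod_cast hpp.pos
  have hdist : |Real.log p - k * P| < r := by
    have heq : t * Real.log p - k * (2 * Real.pi) = t * (Real.log p - k * P) := by
      rw [hP]; field_simp
    rw [heq, abs_mul, abs_of_pos ht] at hk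
    nlinarith [abs_nonneg (Real.log p - k * P)]
  rw [abs_lt] at hdist
  have hlow : Real.exp (k * P - r) < p := by
    calc Real.exp (k * P - r) < Real.exp (Real.log p) := Real.exp_lt_exp.2 (by linarith)
      _ = p := Real.exp_log hp0
  have hupp : (p : ℝ) < Real.exp (k * P + r) := by
    calc (p : ℝ) = Real.exp (Real.log p) := (Real.exp_log hp0).symm
      _ < Real.exp (k * P + r) := Real.exp_lt_exp.2 (by linarith)
  have hlogp_lo : L - 3 < Real.log p := by
    have := Real.log_lt_log (by positivity) hpa
    rw [Real.log_mul hz.ne' (Real.exp_pos _).ne', Real.log_exp] at this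
    rw [hL]; linarith
  have hlogp_hi : Real.log p ≤ L := Real.log_le_log hp0 hpz
  rw [Finset.mem_biUnion]
  refine ⟨k, ?_, ?_⟩
  · rw [Finset.mem_Icc]
    constructor
    · have h1 : (L - 3 - r) / P < k := by rw [div_lt_iff₀ hP0]; linarith
      have h2 : (⌊(L - 3 - r) / P⌋ : ℝ) ≤ (L - 3 - r) / P := Int.floor_le _
      exact_mod_cast (h2.trans_lt h1).le
    · have h1 : (k : ℝ) < (L + r) / P := by rw [lt_div_iff₀ hP0]; linarith
      have h2 : (L + r) / P ≤ ⌈(L + r) / P⌉ := Int.le_ceil _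
      exact_mod_cast (h1.trans_le h2).le
  · rw [Finset.mem_filter, Finset.mem_Ioc]
    refine ⟨⟨?_, ?_⟩, hpp⟩
    · have : (⌊Real.exp (k * P - r)⌋₊ : ℝ) ≤ Real.exp (k * P - r) := Nat.floor_le (Real.exp_pos _).le
      exact_mod_cast (this.trans_lt hlow)
    · have hle : ⌊Real.exp (k * P - r)⌋₊ ≤ ⌈Real.exp (k * P + r)⌉₊ := by
        have h1 : (⌊Real.exp (k * P - r)⌋₊ : ℝ) ≤ Real.exp (k * P - r) := Nat.floor_le (Real.exp_pos _).le
        have h2 : Real.exp (k * P - r) ≤ Real.exp (k * P + r) := Real.exp_le_exp.2 (by linarith)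
        have h3 : Real.exp (k * P + r) ≤ ⌈Real.exp (k * P + r)⌉₊ := Nat.le_ceil _
        exact_mod_cast (h1.trans (h2.trans h3))
      have hNM : ⌊Real.exp (k * P - r)⌋₊ + (⌈Real.exp (k * P + r)⌉₊ - ⌊Real.exp (k * P - r)⌋₊) =
          ⌈Real.exp (k * P + r)⌉₊ := by omega
      rw [hNM]
      exact_mod_cast (hupp.le.trans (Nat.le_ceil _))

/-- The number of indices: `#[⌊(L-3-r)/P⌋, ⌈(L+r)/P⌉] ≤ (3 + 2r)/P + 3 ≤ 3t/2` for `P = 2π/t`, `r ≤ 1/20`,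
`t ≥ 3`. [folklore] -/
theorem card_Icc_indices_le (ht : 3 ≤ t) {r L : ℝ} (hr0 : 0 ≤ r) (hr : r ≤ 1 / 20) :
    ((Finset.Icc ⌊(L - 3 - r) / (2 * Real.pi / t)⌋ ⌈(L + r) / (2 * Real.pi / t)⌉).card : ℝ) ≤ 3 / 2 * t := by
  have htpos : 0 < t := by linarith
  set P : ℝ := 2 * Real.pi / t with hP
  have hP0 : 0 < P := by positivity
  have hπ := Real.pi_gt_d2
  rw [Int.card_Icc]
  set klo : ℤ := ⌊(L - 3 - r) / P⌋ with hklo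
  set khi : ℤ := ⌈(L + r) / P⌉ with hkhi
  have heq : (L + r) / P + 2 - ((L - 3 - r) / P - 1) = (3 + 2 * r) / P + 3 := by
    field_simp; ring
  have hdiff : ((khi + 1 - klo).toNat : ℝ) ≤ (3 + 2 * r) / P + 3 := by
    have h1 : ((⌈(L + r) / P⌉ : ℤ) : ℝ) < (L + r) / P + 1 := Int.ceil_lt_add_one _
    have h2 : (L - 3 - r) / P - 1 < ((⌊(L - 3 - r) / P⌋ : ℤ) : ℝ) := by
      have := Int.lt_floor_add_one ((L - 3 - r) / P); linarith
    rcases le_or_gt 0 (khi + 1 - klo) with hnn | hneg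
    · have hcast : ((khi + 1 - klo).toNat : ℝ) = (khi : ℝ) + 1 - klo := by
        rw [show ((khi + 1 - klo).toNat : ℝ) = (((khi + 1 - klo).toNat : ℤ) : ℝ) by norm_cast,
          Int.toNat_of_nonneg hnn]
        push_cast; ring
      rw [hcast, hkhi, hklo, ← heq]
      linarith
    · rw [Int.toNat_eq_zero.2 hneg.le]
      simp only [Nat.cast_zero]
      positivity
  have h1 : (3 + 2 * r) / P ≤ t / 2 := by
    rw [hP, div_div_eq_mul_div, div_le_div_iff₀ (by positivity) (by norm_num)]
    have h2 : (3 + 2 * r) * 2 ≤ 2 * Real.pi := by linarith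
    nlinarith [mul_le_mul_of_nonneg_left h2 htpos.le]
  linarith

/-! ### The Brun–Titchmarsh regime `3 ≤ |t| ≤ κ z^{9/10}` -/

set_option maxHeartbeats 1600000 in
/-- **Decay on a block, Brun–Titchmarsh regime.** There are absolute `c, κ > 0` and `z₀` such that for all real
`z ≥ z₀`, all `σ ≥ 0` and all `t` with `3 ≤ |t| ≤ κ z^{9/10}`:
`Σ_{z/e³ < p ≤ z} p^{-σ}(1 - cos(t log p)) ≥ c · z^{1-σ}/log z`.
Proof as for the tree's `exists_decaySum_ge_linear`: the block has `θ`-mass `≥ 0.27 z`; the bad primes (`t log p`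
within `ε'` of `2πℤ`, `ε' = 1/(16000(C+1))`, `C` the Brun–Titchmarsh constant of `sum_log_primes_Ioc_le`) lie in
`≤ 3|t|/2` intervals `(e^{kP-r}, e^{kP+r})`, `P = 2π/|t|`, `r = ε'/|t|`, each of length `M ≍ r z ≥ z^{1/10}/12`, hence
(`log M ≥ log z/20`) of `θ`-mass `≤ 21 C (M + 2)`; in total `≤ 794 C ε' z + 63 C |t| ≤ z/10`. The good primes give
`≥ (1 - cos ε') · 0.17 · z^{1-σ}/log z`. [cite: HildebrandTenenbaum1986, §3 Lemma 8 (ii)–(iii), proof of (3.16)] -/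
theorem exists_blockDecaySum_ge :
    ∃ c : ℝ, 0 < c ∧ ∃ κ : ℝ, 0 < κ ∧ ∃ z₀ : ℝ, 0 < z₀ ∧ ∀ z : ℝ, z₀ ≤ z → ∀ σ : ℝ, 0 ≤ σ →
      ∀ t : ℝ, 3 ≤ |t| → |t| ≤ κ * z ^ (9 / 10 : ℝ) →
        c * (z ^ (1 - σ) / Real.log z) ≤
          ∑ p ∈ Nat.primesLE ⌊z⌋₊ \ Nat.primesLE ⌊z * Real.exp (-3)⌋₊,
            (p : ℝ) ^ (-σ) * (1 - Real.cos (t * Real.log p)) := by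
  classical
  obtain ⟨C, hC, hBT⟩ := sum_log_primes_Ioc_le
  obtain ⟨z₁, hz₁, hθ⟩ := exists_theta_block_ge
  -- constants
  set ε' : ℝ := 1 / (16000 * (C + 1)) with hε'
  have hε'0 : 0 < ε' := by positivity
  have hε'20 : ε' ≤ 1 / 20 := by
    rw [hε', div_le_div_iff₀ (by positivity) (by norm_num)]; linarith
  have hCε' : C * ε' ≤ 1 / 16000 := by
    rw [hε', mul_one_div, div_le_div_iff₀ (by positivity) (by norm_num)]; linarith
  set δ : ℝ := 1 - Real.cos ε' with hδ
  have hδ0 : 0 < δ := by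
    have h := two_div_pi_sq_mul_sq_le_one_sub_cos (φ := ε')
      (by rw [abs_of_nonneg hε'0.le]; linarith [Real.pi_gt_d2])
    have : 0 < 2 / Real.pi ^ 2 * ε' ^ 2 := by positivity
    linarith
  set κ : ℝ := ε' / 12 with hκ
  have hκ0 : 0 < κ := by positivity
  -- thresholds: `log z ≥ 60`, `z ≥ z₁`, `z^{1/10} ≥ 1260 (C + 1)`
  set Z : ℝ := max (Real.exp 60) (max z₁ ((1260 * (C + 1)) ^ 10)) with hZ
  refine ⟨17 / 100 * δ, by positivity, κ, hκ0, Z, lt_of_lt_of_le (Real.exp_pos 60) (le_max_left _ _),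
    fun z hz σ hσ t ht3 htκ => ?_⟩
  have hz60 : Real.exp 60 ≤ z := le_trans (le_max_left _ _) hz
  have hzz₁ : z₁ ≤ z := le_trans (le_trans (le_max_left _ _) (le_max_right _ _)) hz
  have hzC : (1260 * (C + 1)) ^ 10 ≤ z := le_trans (le_trans (le_max_right _ _) (le_max_right _ _)) hz
  have hz0 : 0 < z := lt_of_lt_of_le (Real.exp_pos _) hz60
  have hz1 : 1 < z := lt_of_lt_of_le (by have := Real.add_one_le_exp (60 : ℝ); linarith) hz60
  set L : ℝ := Real.log z with hL
  have hL60 : 60 ≤ L := by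
    have := Real.log_le_log (Real.exp_pos _) hz60; rwa [Real.log_exp] at this
  have hL0 : 0 < L := by linarith
  -- `z^{1/10}` and `z^{9/10}`
  have hz10 : 0 < z ^ (1 / 10 : ℝ) := Real.rpow_pos_of_pos hz0 _
  have hz910 : 0 < z ^ (9 / 10 : ℝ) := Real.rpow_pos_of_pos hz0 _
  have hzsplit : z ^ (1 / 10 : ℝ) * z ^ (9 / 10 : ℝ) = z := by
    rw [← Real.rpow_add hz0]; norm_num
  have hz10C : 1260 * (C + 1) ≤ z ^ (1 / 10 : ℝ) := by
    have h2 := Real.rpow_le_rpow (by positivity) hzC (by norm_num : (0 : ℝ) ≤ 1 / 10)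
    rwa [← Real.rpow_natCast, ← Real.rpow_mul (by positivity), show ((10 : ℕ) : ℝ) * (1 / 10) = 1 by
      norm_num, Real.rpow_one] at h2
  have hlogz10 : Real.log (z ^ (1 / 10 : ℝ)) = L / 10 := by rw [Real.log_rpow hz0, hL]; ring
  -- reduce to `t > 0`
  wlog htpos : 0 < t generalizing t
  · have ht0 : t ≤ 0 := le_of_not_gt htpos
    have htne : t ≠ 0 := by intro h; rw [h, abs_zero] at ht3; linarith
    have h := this (-t) (by rwa [abs_neg]) (by rwa [abs_neg]) (by
      rcases lt_or_eq_of_le ht0 with h | h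
      · linarith
      · exact absurd h htne)
    simpa [neg_mul, Real.cos_neg] using h
  rw [abs_of_pos htpos] at ht3 htκ
  have hπ := Real.pi_gt_d2
  have hπ' := Real.pi_lt_d2
  have ht12 : t * 12 ≤ ε' * z ^ (9 / 10 : ℝ) := by rw [hκ] at htκ; linarith
  set P : ℝ := 2 * Real.pi / t with hP
  set r : ℝ := ε' / t with hr
  have hP0 : 0 < P := by positivity
  have hP21 : P ≤ 21 / 10 := by rw [hP, div_le_iff₀ htpos]; linarith
  have hr0 : 0 < r := by positivity
  have hr20 : r ≤ 1 / 20 := by rw [hr, div_le_iff₀ htpos]; linarith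
  have hrt : r * t = ε' := by rw [hr]; field_simp
  -- the block and its mass
  set Q : Finset ℕ := Nat.primesLE ⌊z⌋₊ \ Nat.primesLE ⌊z * Real.exp (-3)⌋₊ with hQ
  have hza : z * Real.exp (-3) ≤ z := by
    have : Real.exp (-3) ≤ 1 := Real.exp_le_one_iff.2 (by norm_num)
    exact mul_le_of_le_one_right hz0.le this
  have hQmass : ∑ p ∈ Q, Real.log p = θ z - θ (z * Real.exp (-3)) := by
    rw [hQ, theta_sub_theta_eq_sum_sdiff hza]
  have htotal : 27 / 100 * z ≤ ∑ p ∈ Q, Real.log p := by rw [hQmass]; exact hθ z hzz₁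
  set Bad : Finset ℕ := Q.filter (fun p => ∃ k : ℤ, |t * Real.log p - k * (2 * Real.pi)| < ε') with hBad
  set Good : Finset ℕ := Q.filter (fun p => ¬ ∃ k : ℤ, |t * Real.log p - k * (2 * Real.pi)| < ε') with hGood
  have hsplit : ∑ p ∈ Q, Real.log p = ∑ p ∈ Good, Real.log p + ∑ p ∈ Bad, Real.log p := by
    rw [hGood, hBad, add_comm, Finset.sum_filter_add_sum_filter_not]
  -- ### the bad mass is at most `z/10`
  have hbad : ∑ p ∈ Bad, Real.log p ≤ z / 10 := by
    set Kset : Finset ℤ := Finset.Icc ⌊(L - 3 - r) / P⌋ ⌈(L + r) / P⌉ with hKset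
    set N : ℤ → ℕ := fun k => ⌊Real.exp (k * P - r)⌋₊ with hN
    set M : ℤ → ℕ := fun k => ⌈Real.exp (k * P + r)⌉₊ - ⌊Real.exp (k * P - r)⌋₊ with hM
    set S : ℤ → Finset ℕ := fun k => (Ioc (N k) (N k + M k)).filter Nat.Prime with hS
    -- (1) covering
    have hcover : Bad ⊆ Kset.biUnion S := by
      intro p hp
      rw [hBad, Finset.mem_filter] at hp
      have h := mem_biUnion_of_bad (z := z) hz0 htpos hr0 hp.1 (by rw [hrt]; exact hp.2)
      simpa only [hKset, hS, hN, hM, hP, hL] using h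
    -- (2) Brun–Titchmarsh on each `S k`
    have hper : ∀ k ∈ Kset, ∑ p ∈ S k, Real.log p ≤ 530 * C * ε' * z / t + 42 * C := by
      intro k hk
      rw [hKset, Finset.mem_Icc] at hk
      set E : ℝ := Real.exp (k * P) with hE
      have hE0 : 0 < E := Real.exp_pos _
      have hkP_lo : L - 3 - r - P ≤ k * P := by
        have h1 : ((⌊(L - 3 - r) / P⌋ : ℤ) : ℝ) ≤ k := by exact_mod_cast hk.1
        have h2 : (L - 3 - r) / P - 1 < ⌊(L - 3 - r) / P⌋ := by
          have := Int.lt_floor_add_one ((L - 3 - r) / P); linarith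
        have h3 : (L - 3 - r) / P - 1 ≤ k := by linarith
        have := mul_le_mul_of_nonneg_right h3 hP0.le
        rwa [sub_mul, div_mul_cancel₀ _ hP0.ne', one_mul] at this
      have hkP_hi : k * P ≤ L + r + P := by
        have h1 : (k : ℝ) ≤ ((⌈(L + r) / P⌉ : ℤ) : ℝ) := by exact_mod_cast hk.2
        have h2 : ((⌈(L + r) / P⌉ : ℤ) : ℝ) < (L + r) / P + 1 := Int.ceil_lt_add_one _
        have h3 : (k : ℝ) ≤ (L + r) / P + 1 := by linarith
        have := mul_le_mul_of_nonneg_right h3 hP0.le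
        rwa [add_mul, div_mul_cancel₀ _ hP0.ne', one_mul] at this
      have hE_hi : E ≤ Real.exp (23 / 10) * z := by
        calc E ≤ Real.exp (L + (23 / 10)) := Real.exp_le_exp.2 (by linarith)
          _ = Real.exp (23 / 10) * z := by rw [Real.exp_add, hL, Real.exp_log hz0]; ring
      have hE_lo : z * Real.exp (-(53 / 10)) ≤ E := by
        calc z * Real.exp (-(53 / 10)) = Real.exp (L + -(53 / 10)) := by
              rw [Real.exp_add, hL, Real.exp_log hz0]
          _ ≤ E := Real.exp_le_exp.2 (by linarith)
      obtain ⟨hexp_lo, hexp_hi⟩ := exp_sub_exp_neg_bounds hr0.le hr20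
      have hfloor_le : ⌊Real.exp (k * P - r)⌋₊ ≤ ⌈Real.exp (k * P + r)⌉₊ := by
        have h5 : (⌊Real.exp (k * P - r)⌋₊ : ℝ) ≤ Real.exp (k * P - r) := Nat.floor_le (Real.exp_pos _).le
        have h6 : Real.exp (k * P - r) ≤ Real.exp (k * P + r) := Real.exp_le_exp.2 (by linarith)
        exact_mod_cast (h5.trans (h6.trans (Nat.le_ceil _)))
      have h3E : Real.exp (k * P + r) = E * Real.exp r := by rw [hE, ← Real.exp_add]
      have h4E : Real.exp (k * P - r) = E * Real.exp (-r) := by rw [hE, ← Real.exp_add]; ring_nf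
      have hMreal_hi : (M k : ℝ) ≤ 21 / 10 * r * E + 2 := by
        simp only [hM]
        have h1 : (⌈Real.exp (k * P + r)⌉₊ : ℝ) < Real.exp (k * P + r) + 1 := Nat.ceil_lt_add_one (Real.exp_pos _).le
        have h2 : Real.exp (k * P - r) - 1 < ⌊Real.exp (k * P - r)⌋₊ := by
          have := Nat.lt_floor_add_one (Real.exp (k * P - r)); linarith
        rw [Nat.cast_sub hfloor_le]
        have h7 : E * Real.exp r - E * Real.exp (-r) = E * (Real.exp r - Real.exp (-r)) := by ring
        have h8 := mul_le_mul_of_nonneg_left hexp_hi hE0.le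
        nlinarith [h7, h8, h1, h2, h3E, h4E]
      have hMreal_lo : 19 / 10 * r * E ≤ (M k : ℝ) := by
        simp only [hM]
        have h1 : Real.exp (k * P + r) ≤ (⌈Real.exp (k * P + r)⌉₊ : ℝ) := Nat.le_ceil _
        have h2 : (⌊Real.exp (k * P - r)⌋₊ : ℝ) ≤ Real.exp (k * P - r) := Nat.floor_le (Real.exp_pos _).le
        rw [Nat.cast_sub hfloor_le]
        have h7 : E * Real.exp r - E * Real.exp (-r) = E * (Real.exp r - Real.exp (-r)) := by ring
        have h8 := mul_le_mul_of_nonneg_left hexp_lo hE0.le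
        nlinarith [h7, h8, h1, h2, h3E, h4E]
      -- `r E ≥ 12 e^{-5.3} z^{1/10}`
      have hrE : z ^ (1 / 10 : ℝ) * Real.exp (-(53 / 10)) * 12 ≤ r * E := by
        have h1 : 12 * z ^ (1 / 10 : ℝ) ≤ r * z := by
          rw [hr, div_mul_eq_mul_div, le_div_iff₀ htpos]
          have h := mul_le_mul_of_nonneg_right ht12 hz10.le
          calc 12 * z ^ (1 / 10 : ℝ) * t = t * 12 * z ^ (1 / 10 : ℝ) := by ring
            _ ≤ ε' * z ^ (9 / 10 : ℝ) * z ^ (1 / 10 : ℝ) := h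
            _ = ε' * z := by rw [mul_assoc, mul_comm (z ^ (9 / 10 : ℝ)), hzsplit]
        have he0 : 0 ≤ Real.exp (-(53 / 10)) := (Real.exp_pos _).le
        calc z ^ (1 / 10 : ℝ) * Real.exp (-(53 / 10)) * 12
            = (12 * z ^ (1 / 10 : ℝ)) * Real.exp (-(53 / 10)) := by ring
          _ ≤ (r * z) * Real.exp (-(53 / 10)) := mul_le_mul_of_nonneg_right h1 he0
          _ = r * (z * Real.exp (-(53 / 10))) := by ring
          _ ≤ r * E := mul_le_mul_of_nonneg_left hE_lo hr0.le
      have he53 := one_div_le_exp_neg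
      have hM_lo : z ^ (1 / 10 : ℝ) / 12 ≤ (M k : ℝ) := by
        have h1 : z ^ (1 / 10 : ℝ) * (1 / 250) * 12 ≤ z ^ (1 / 10 : ℝ) * Real.exp (-(53 / 10)) * 12 :=
          mul_le_mul_of_nonneg_right (mul_le_mul_of_nonneg_left he53 hz10.le) (by norm_num)
        have h2 : z ^ (1 / 10 : ℝ) / 12 ≤ 19 / 10 * (z ^ (1 / 10 : ℝ) * (1 / 250) * 12) := by
          rw [div_le_iff₀ (by norm_num : (0 : ℝ) < 12)]
          nlinarith [hz10]
        linarith
      have hM2 : 2 ≤ M k := by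
        have : (2 : ℝ) ≤ M k := by
          have : (24 : ℝ) ≤ z ^ (1 / 10 : ℝ) := by nlinarith [hz10C, hC]
          linarith
        exact_mod_cast this
      have hM0 : (0 : ℝ) < M k := by exact_mod_cast (lt_of_lt_of_le zero_lt_two hM2)
      have hlogM : L / 20 ≤ Real.log (M k) := by
        have h1 : Real.log (z ^ (1 / 10 : ℝ) / 12) ≤ Real.log (M k) := Real.log_le_log (by positivity) hM_lo
        rw [Real.log_div hz10.ne' (by norm_num), hlogz10] at h1
        have hl12 : Real.log 12 ≤ 3 := by
          rw [Real.log_le_iff_le_exp (by norm_num)]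
          linarith [exp_three_gt]
        linarith
      have hlogNM : Real.log (((N k + M k : ℕ)) : ℝ) ≤ L + 3 := by
        have hNM' : N k + M k = ⌈Real.exp (k * P + r)⌉₊ := by
          simp only [hN, hM]; omega
        have hNM : ((N k + M k : ℕ) : ℝ) ≤ Real.exp (k * P + r) + 1 := by
          rw [hNM']; exact (Nat.ceil_lt_add_one (Real.exp_pos _).le).le
        have hpos : (0 : ℝ) < ((N k + M k : ℕ) : ℝ) := by
          have hN0 : (0 : ℝ) ≤ (N k : ℝ) := Nat.cast_nonneg _
          push_cast; linarith
        calc Real.log (((N k + M k : ℕ)) : ℝ) ≤ Real.log (Real.exp (k * P + r) + 1) := Real.log_le_log hpos hNM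
          _ ≤ Real.log (Real.exp (L + 3)) := by
              refine Real.log_le_log (by positivity) ?_
              have h1 : Real.exp (k * P + r) ≤ Real.exp (L + 2.3) := Real.exp_le_exp.2 (by linarith)
              have h3 : Real.exp (L + 3) = Real.exp (L + 2.3) * Real.exp 0.7 := by rw [← Real.exp_add]; ring_nf
              have h4 : (1 : ℝ) + 0.7 ≤ Real.exp 0.7 := by have := Real.add_one_le_exp (0.7 : ℝ); linarith
              have h5 : (33 : ℝ) ≤ Real.exp (L + 2.3) := by have := Real.add_one_le_exp (L + 2.3); linarith
              have h6 := mul_le_mul_of_nonneg_left h4 (Real.exp_pos (L + 2.3)).le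
              rw [h3]; linarith
          _ = L + 3 := Real.log_exp _
      have hbt := hBT (N k) (M k) hM2
      calc ∑ p ∈ S k, Real.log p ≤ C * (M k) * Real.log (((N k + M k : ℕ)) : ℝ) / Real.log (M k) := hbt
        _ ≤ C * (M k) * (L + 3) / (L / 20) := by
            have hnum : C * (M k) * Real.log (((N k + M k : ℕ)) : ℝ) ≤ C * (M k) * (L + 3) :=
              mul_le_mul_of_nonneg_left hlogNM (by positivity)
            calc C * (M k) * Real.log (((N k + M k : ℕ)) : ℝ) / Real.log (M k)
                ≤ C * (M k) * (L + 3) / Real.log (M k) := div_le_div_of_nonneg_right hnum (by linarith)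
              _ ≤ C * (M k) * (L + 3) / (L / 20) := div_le_div_of_nonneg_left (by positivity) (by positivity) hlogM
        _ ≤ C * (M k) * 21 := by
            rw [div_le_iff₀ (by positivity)]
            have : C * (M k) * (L + 3) ≤ C * (M k) * (21 * (L / 20)) :=
              mul_le_mul_of_nonneg_left (by linarith) (by positivity)
            linarith
        _ ≤ C * (21 / 10 * r * E + 2) * 21 :=
            mul_le_mul_of_nonneg_right (mul_le_mul_of_nonneg_left hMreal_hi hC.le) (by norm_num)
        _ ≤ 530 * C * ε' * z / t + 42 * C := by
            have hrE_hi : r * E ≤ ε' / t * (12 * z) := by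
              rw [hr]
              exact mul_le_mul_of_nonneg_left (le_trans hE_hi (mul_le_mul_of_nonneg_right exp_le_twelve hz0.le))
                (by positivity)
            have heq : C * (21 / 10 * r * E + 2) * 21 = 441 / 10 * C * (r * E) + 42 * C := by ring
            rw [heq]
            have h2 : 441 / 10 * C * (r * E) ≤ 441 / 10 * C * (ε' / t * (12 * z)) :=
              mul_le_mul_of_nonneg_left hrE_hi (by positivity)
            have h3 : 441 / 10 * C * (ε' / t * (12 * z)) ≤ 530 * C * ε' * z / t := by
              rw [show 441 / 10 * C * (ε' / t * (12 * z)) = (5292 / 10) * C * ε' * z / t by ring]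
              exact div_le_div_of_nonneg_right (by nlinarith [mul_pos hC hε'0, hz0]) htpos.le
            linarith
    -- (3) the number of `k`
    have hcardK : (Kset.card : ℝ) ≤ 3 / 2 * t := card_Icc_indices_le ht3 hr0.le hr20
    -- (4) assemble
    calc ∑ p ∈ Bad, Real.log p ≤ ∑ p ∈ Kset.biUnion S, Real.log p :=
          Finset.sum_le_sum_of_subset_of_nonneg hcover fun p hp _ => by
            obtain ⟨k, -, hk⟩ := Finset.mem_biUnion.1 hp
            exact Real.log_nonneg (by exact_mod_cast (Finset.mem_filter.1 hk).2.one_lt.le)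
      _ ≤ ∑ k ∈ Kset, ∑ p ∈ S k, Real.log p := by
          refine sum_biUnion_le_sum'' Kset S fun p => ?_
          rcases Nat.eq_zero_or_pos p with rfl | hp
          · simp
          · exact Real.log_nonneg (by exact_mod_cast hp)
      _ ≤ ∑ k ∈ Kset, (530 * C * ε' * z / t + 42 * C) := Finset.sum_le_sum hper
      _ = Kset.card * (530 * C * ε' * z / t + 42 * C) := by rw [Finset.sum_const, nsmul_eq_mul]
      _ ≤ 3 / 2 * t * (530 * C * ε' * z / t + 42 * C) := mul_le_mul_of_nonneg_right hcardK (by positivity)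
      _ = 795 * (C * ε') * z + 63 * C * t := by field_simp; ring
      _ ≤ z / 10 := by
          have h1 : 795 * (C * ε') * z ≤ 795 / 16000 * z := mul_le_mul_of_nonneg_right (by linarith) hz0.le
          -- `63 C t ≤ 63 C κ z^{9/10} ≤ z^{9/10} ≤ z/(1260 (C+1)) ≤ ...`; we use `t ≤ κ z^{9/10} ≤ z^{9/10}` and
          -- `z^{1/10} ≥ 1260 (C+1)`
          have hκ1 : κ ≤ 1 := by rw [hκ]; linarith
          have ht_le : t ≤ z ^ (9 / 10 : ℝ) := le_trans htκ (mul_le_of_le_one_left hz910.le hκ1)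
          have h2 : 63 * C * t ≤ z / 20 := by
            have h3 : 63 * C * t ≤ 63 * C * z ^ (9 / 10 : ℝ) := mul_le_mul_of_nonneg_left ht_le (by positivity)
            have h4 : 1260 * (C + 1) * z ^ (9 / 10 : ℝ) ≤ z := by
              calc 1260 * (C + 1) * z ^ (9 / 10 : ℝ) ≤ z ^ (1 / 10 : ℝ) * z ^ (9 / 10 : ℝ) :=
                    mul_le_mul_of_nonneg_right hz10C hz910.le
                _ = z := hzsplit
            nlinarith [hz910, hC]
          linarith
  -- ### the good primes
  have hgood_mass : 17 / 100 * z ≤ ∑ p ∈ Good, Real.log p := by linarith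
  have hGsub : Good ⊆ Q := Finset.filter_subset _ _
  have hfar : ∀ p ∈ Good, ∀ k : ℤ, ε' ≤ |t * Real.log p - k * (2 * Real.pi)| := by
    intro p hp k
    rw [hGood, Finset.mem_filter] at hp
    have h := hp.2
    push Not at h
    exact h k
  have hmain := blockDecaySum_ge_of_good_mass (t := t) hz1 hσ hε'0.le hGsub hfar hgood_mass
  have hzσ : 0 < z ^ (-σ) := Real.rpow_pos_of_pos hz0 _
  calc 17 / 100 * δ * (z ^ (1 - σ) / Real.log z) = (1 - Real.cos ε') * z ^ (-σ) / Real.log z * (17 / 100 * z) := by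
        rw [show (1 : ℝ) - σ = -σ + 1 by ring, Real.rpow_add hz0, Real.rpow_one, ← hδ]
        field_simp
    _ ≤ _ := hmain

/-! ### The pigeonhole regime `3 ≤ |t| ≤ z/(16 log z)` -/

/-- An open real interval of length `≤ 1` contains at most one natural number. [folklore] -/
theorem card_filter_mem_Ioo_le_one {A B : ℝ} (hAB : B ≤ A + 1) (s : Finset ℕ) :
    #(s.filter (fun n : ℕ => A < (n : ℝ) ∧ (n : ℝ) < B)) ≤ 1 := by
  rw [Finset.card_le_one]
  intro a ha b hb
  rw [Finset.mem_filter] at ha hb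
  have h1 : (a : ℝ) < b + 1 := by linarith [ha.2.1, hb.2.2]
  have h2 : (b : ℝ) < a + 1 := by linarith [hb.2.1, ha.2.2]
  have h1' : a < b + 1 := by exact_mod_cast h1
  have h2' : b < a + 1 := by exact_mod_cast h2
  omega

set_option maxHeartbeats 800000 in
/-- **Decay on a block, pigeonhole regime.** There are absolute `c > 0` and `z₀` such that for all real `z ≥ z₀`,
`σ ≥ 0` and `t` with `3 ≤ |t| ≤ z/(16 log z)`:
`Σ_{z/e³ < p ≤ z} p^{-σ}(1 - cos(t log p)) ≥ c (t/z)² z^{1-σ}/log z`.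
With `ε' = |t|/(480 z)` (`≤ 1/20`) the bad intervals `(e^{kP-r}, e^{kP+r})`, `r = ε'/|t| = 1/(480 z)`, have length
`≤ 2.1 r e^{kP} ≤ 2.1 · 12 z/(480 z) < 1`, so each contains at most one prime; there are `≤ 3|t|/2` of them, so the
bad `θ`-mass is `≤ (3|t|/2) log z ≤ (3/32) z < z/10`, and the good mass `≥ 0.17 z` gives the bound with
`1 - cos ε' ≥ (2/π²) ε'²`. [cite: HildebrandTenenbaum1986, §3 Lemma 8 (ii), proof of (3.16)] -/
theorem exists_blockDecaySum_ge_of_le_div_log :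
    ∃ c : ℝ, 0 < c ∧ ∃ z₀ : ℝ, 0 < z₀ ∧ ∀ z : ℝ, z₀ ≤ z → ∀ σ : ℝ, 0 ≤ σ →
      ∀ t : ℝ, 3 ≤ |t| → |t| ≤ z / (16 * Real.log z) →
        c * ((t / z) ^ 2 * (z ^ (1 - σ) / Real.log z)) ≤
          ∑ p ∈ Nat.primesLE ⌊z⌋₊ \ Nat.primesLE ⌊z * Real.exp (-3)⌋₊,
            (p : ℝ) ^ (-σ) * (1 - Real.cos (t * Real.log p)) := by
  classical
  obtain ⟨z₁, hz₁, hθ⟩ := exists_theta_block_ge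
  set Z : ℝ := max (Real.exp 60) z₁ with hZ
  refine ⟨17 / 100 * (2 / Real.pi ^ 2) * (1 / 480) ^ 2, by positivity, Z,
    lt_of_lt_of_le (Real.exp_pos 60) (le_max_left _ _), fun z hz σ hσ t ht3 htz => ?_⟩
  have hz60 : Real.exp 60 ≤ z := le_trans (le_max_left _ _) hz
  have hzz₁ : z₁ ≤ z := le_trans (le_max_right _ _) hz
  have hz0 : 0 < z := lt_of_lt_of_le (Real.exp_pos _) hz60
  have hz1 : 1 < z := lt_of_lt_of_le (by have := Real.add_one_le_exp (60 : ℝ); linarith) hz60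
  set L : ℝ := Real.log z with hL
  have hL60 : 60 ≤ L := by
    have := Real.log_le_log (Real.exp_pos _) hz60; rwa [Real.log_exp] at this
  have hL0 : 0 < L := by linarith
  -- reduce to `t > 0`
  wlog htpos : 0 < t generalizing t
  · have ht0 : t ≤ 0 := le_of_not_gt htpos
    have htne : t ≠ 0 := by intro h; rw [h, abs_zero] at ht3; linarith
    have h := this (-t) (by rwa [abs_neg]) (by rwa [abs_neg]) (by
      rcases lt_or_eq_of_le ht0 with h | h
      · linarith
      · exact absurd h htne)
    simpa [neg_mul, Real.cos_neg, neg_div] using h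
  rw [abs_of_pos htpos] at ht3 htz
  have hπ := Real.pi_gt_d2
  have hπ' := Real.pi_lt_d2
  -- `t ≤ z/(16 L) ≤ z`
  have htz' : t * (16 * L) ≤ z := by rwa [le_div_iff₀ (by positivity)] at htz
  have htle : t ≤ z := by nlinarith
  set ε' : ℝ := t / (480 * z) with hε'
  have hε'0 : 0 < ε' := by positivity
  have hε'20 : ε' ≤ 1 / 20 := by
    rw [hε', div_le_div_iff₀ (by positivity) (by norm_num)]; linarith
  set P : ℝ := 2 * Real.pi / t with hP
  set r : ℝ := ε' / t with hr
  have hP0 : 0 < P := by positivity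
  have hP21 : P ≤ 21 / 10 := by rw [hP, div_le_iff₀ htpos]; linarith
  have hr0 : 0 < r := by positivity
  have hreq : r = 1 / (480 * z) := by rw [hr, hε']; field_simp
  have hr20 : r ≤ 1 / 20 := by
    rw [hreq, div_le_div_iff₀ (by positivity) (by norm_num)]; nlinarith
  have hrt : r * t = ε' := by rw [hr]; field_simp
  -- the block and its mass
  set Q : Finset ℕ := Nat.primesLE ⌊z⌋₊ \ Nat.primesLE ⌊z * Real.exp (-3)⌋₊ with hQ
  have hza : z * Real.exp (-3) ≤ z := by
    have : Real.exp (-3) ≤ 1 := Real.exp_le_one_iff.2 (by norm_num)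
    exact mul_le_of_le_one_right hz0.le this
  have hQmass : ∑ p ∈ Q, Real.log p = θ z - θ (z * Real.exp (-3)) := by
    rw [hQ, theta_sub_theta_eq_sum_sdiff hza]
  have htotal : 27 / 100 * z ≤ ∑ p ∈ Q, Real.log p := by rw [hQmass]; exact hθ z hzz₁
  set Bad : Finset ℕ := Q.filter (fun p => ∃ k : ℤ, |t * Real.log p - k * (2 * Real.pi)| < ε') with hBad
  set Good : Finset ℕ := Q.filter (fun p => ¬ ∃ k : ℤ, |t * Real.log p - k * (2 * Real.pi)| < ε') with hGood
  have hsplit : ∑ p ∈ Q, Real.log p = ∑ p ∈ Good, Real.log p + ∑ p ∈ Bad, Real.log p := by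
    rw [hGood, hBad, add_comm, Finset.sum_filter_add_sum_filter_not]
  -- ### the bad mass is at most `z/10`: each interval holds at most one prime
  have hbad : ∑ p ∈ Bad, Real.log p ≤ z / 10 := by
    set Kset : Finset ℤ := Finset.Icc ⌊(L - 3 - r) / P⌋ ⌈(L + r) / P⌉ with hKset
    -- bad primes indexed by `k`, as subsets of `Q`
    set S : ℤ → Finset ℕ := fun k => Q.filter (fun p : ℕ => Real.exp (k * P - r) < (p : ℝ) ∧
      (p : ℝ) < Real.exp (k * P + r)) with hS
    have hcover : Bad ⊆ Kset.biUnion S := by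
      intro p hp
      rw [hBad, Finset.mem_filter] at hp
      obtain ⟨hpQ, k, hk⟩ := hp
      obtain ⟨hpp, hpa, hpz⟩ := mem_block_iff_aux hz0.le hpQ
      have hp0 : (0 : ℝ) < p := by exact_mod_cast hpp.pos
      have hdist : |Real.log p - k * P| < r := by
        have heq : t * Real.log p - k * (2 * Real.pi) = t * (Real.log p - k * P) := by rw [hP]; field_simp
        rw [heq, abs_mul, abs_of_pos htpos] at hk
        rw [hr, lt_div_iff₀ htpos]; linarith
      rw [abs_lt] at hdist
      have hlogp_lo : L - 3 < Real.log p := by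
        have := Real.log_lt_log (by positivity) hpa
        rw [Real.log_mul hz0.ne' (Real.exp_pos _).ne', Real.log_exp] at this
        rw [hL]; linarith
      have hlogp_hi : Real.log p ≤ L := Real.log_le_log hp0 hpz
      rw [Finset.mem_biUnion]
      refine ⟨k, ?_, ?_⟩
      · rw [hKset, Finset.mem_Icc]
        constructor
        · have h1 : (L - 3 - r) / P < k := by rw [div_lt_iff₀ hP0]; linarith
          have h2 : (⌊(L - 3 - r) / P⌋ : ℝ) ≤ (L - 3 - r) / P := Int.floor_le _
          exact_mod_cast (h2.trans_lt h1).le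
        · have h1 : (k : ℝ) < (L + r) / P := by rw [lt_div_iff₀ hP0]; linarith
          have h2 : (L + r) / P ≤ ⌈(L + r) / P⌉ := Int.le_ceil _
          exact_mod_cast (h1.trans_le h2).le
      · rw [hS, Finset.mem_filter]
        refine ⟨hpQ, ?_, ?_⟩
        · calc Real.exp (k * P - r) < Real.exp (Real.log p) := Real.exp_lt_exp.2 (by linarith)
            _ = p := Real.exp_log hp0
        · calc (p : ℝ) = Real.exp (Real.log p) := (Real.exp_log hp0).symm
            _ < Real.exp (k * P + r) := Real.exp_lt_exp.2 (by linarith)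
    -- each `S k` has at most one element (for `k ∈ Kset`, where `e^{kP} ≤ 12 z`) and its mass is `≤ L`
    have hper : ∀ k ∈ Kset, ∑ p ∈ S k, Real.log p ≤ L := by
      intro k hk
      rw [hKset, Finset.mem_Icc] at hk
      set E : ℝ := Real.exp (k * P) with hE
      have hE0 : 0 < E := Real.exp_pos _
      have hkP_hi : k * P ≤ L + r + P := by
        have h1 : (k : ℝ) ≤ ((⌈(L + r) / P⌉ : ℤ) : ℝ) := by exact_mod_cast hk.2
        have h2 : ((⌈(L + r) / P⌉ : ℤ) : ℝ) < (L + r) / P + 1 := Int.ceil_lt_add_one _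
        have h3 : (k : ℝ) ≤ (L + r) / P + 1 := by linarith
        have := mul_le_mul_of_nonneg_right h3 hP0.le
        rwa [add_mul, div_mul_cancel₀ _ hP0.ne', one_mul] at this
      have hE_hi : E ≤ 12 * z := by
        calc E ≤ Real.exp (L + (23 / 10)) := Real.exp_le_exp.2 (by linarith)
          _ = Real.exp (23 / 10) * z := by rw [Real.exp_add, hL, Real.exp_log hz0]; ring
          _ ≤ 12 * z := mul_le_mul_of_nonneg_right exp_le_twelve hz0.le
      -- length `< 1`
      obtain ⟨-, hexp_hi⟩ := exp_sub_exp_neg_bounds hr0.le hr20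
      have hlen : Real.exp (k * P + r) ≤ Real.exp (k * P - r) + 1 := by
        have h3E : Real.exp (k * P + r) = E * Real.exp r := by rw [hE, ← Real.exp_add]
        have h4E : Real.exp (k * P - r) = E * Real.exp (-r) := by rw [hE, ← Real.exp_add]; ring_nf
        rw [h3E, h4E]
        have hrr : Real.exp (-r) ≤ Real.exp r := Real.exp_le_exp.2 (by linarith)
        have h1 : E * (Real.exp r - Real.exp (-r)) ≤ 12 * z * (21 / 10 * r) :=
          mul_le_mul hE_hi hexp_hi (by linarith) (by positivity)
        have h2 : 12 * z * (21 / 10 * r) ≤ 1 := by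
          rw [hreq]; field_simp; nlinarith
        nlinarith
      have hcard : #(S k) ≤ 1 := by
        rw [hS]; exact card_filter_mem_Ioo_le_one hlen Q
      -- mass `≤ L`
      have hle : ∀ p ∈ S k, Real.log p ≤ L := by
        intro p hp
        rw [hS, Finset.mem_filter] at hp
        obtain ⟨hpp, -, hpz⟩ := mem_block_iff_aux hz0.le hp.1
        exact Real.log_le_log (by exact_mod_cast hpp.pos) hpz
      calc ∑ p ∈ S k, Real.log p ≤ ∑ p ∈ S k, L := Finset.sum_le_sum hle
        _ = #(S k) * L := by rw [Finset.sum_const, nsmul_eq_mul]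
        _ ≤ 1 * L := mul_le_mul_of_nonneg_right (by exact_mod_cast hcard) hL0.le
        _ = L := one_mul L
    have hcardK : (Kset.card : ℝ) ≤ 3 / 2 * t := card_Icc_indices_le ht3 hr0.le hr20
    calc ∑ p ∈ Bad, Real.log p ≤ ∑ p ∈ Kset.biUnion S, Real.log p :=
          Finset.sum_le_sum_of_subset_of_nonneg hcover fun p hp _ => by
            obtain ⟨k, -, hk⟩ := Finset.mem_biUnion.1 hp
            obtain ⟨hpp, -, -⟩ := mem_block_iff_aux hz0.le (Finset.mem_filter.1 hk).1
            exact Real.log_nonneg (by exact_mod_cast hpp.one_lt.le)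
      _ ≤ ∑ k ∈ Kset, ∑ p ∈ S k, Real.log p := by
          refine sum_biUnion_le_sum'' Kset S fun p => ?_
          rcases Nat.eq_zero_or_pos p with rfl | hp
          · simp
          · exact Real.log_nonneg (by exact_mod_cast hp)
      _ ≤ ∑ k ∈ Kset, L := Finset.sum_le_sum hper
      _ = Kset.card * L := by rw [Finset.sum_const, nsmul_eq_mul]
      _ ≤ 3 / 2 * t * L := mul_le_mul_of_nonneg_right hcardK hL0.le
      _ ≤ z / 10 := by
          rw [le_div_iff₀ (by norm_num)]
          nlinarith
  -- ### the good primes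
  have hgood_mass : 17 / 100 * z ≤ ∑ p ∈ Good, Real.log p := by linarith
  have hGsub : Good ⊆ Q := Finset.filter_subset _ _
  have hfar : ∀ p ∈ Good, ∀ k : ℤ, ε' ≤ |t * Real.log p - k * (2 * Real.pi)| := by
    intro p hp k
    rw [hGood, Finset.mem_filter] at hp
    have h := hp.2
    push Not at h
    exact h k
  have hmain := blockDecaySum_ge_of_good_mass (t := t) hz1 hσ hε'0.le hGsub hfar hgood_mass
  have hzσ : 0 < z ^ (-σ) := Real.rpow_pos_of_pos hz0 _
  -- `1 - cos ε' ≥ (2/π²) ε'²`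
  have hcosε : 2 / Real.pi ^ 2 * ε' ^ 2 ≤ 1 - Real.cos ε' :=
    two_div_pi_sq_mul_sq_le_one_sub_cos (by rw [abs_of_nonneg hε'0.le]; linarith)
  calc 17 / 100 * (2 / Real.pi ^ 2) * (1 / 480) ^ 2 * ((t / z) ^ 2 * (z ^ (1 - σ) / Real.log z))
      = (2 / Real.pi ^ 2 * ε' ^ 2) * (z ^ (-σ) / Real.log z * (17 / 100 * z)) := by
        rw [show (1 : ℝ) - σ = -σ + 1 by ring, Real.rpow_add hz0, Real.rpow_one, hε']
        field_simp
    _ ≤ (1 - Real.cos ε') * (z ^ (-σ) / Real.log z * (17 / 100 * z)) :=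
        mul_le_mul_of_nonneg_right hcosε (by positivity)
    _ = (1 - Real.cos ε') * z ^ (-σ) / Real.log z * (17 / 100 * z) := by ring
    _ ≤ _ := hmain

end Literature.NumberTheory.Sieve
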